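import Mathlib
import HarnessLib
import Summits.HubbardSuperconductivity.HubbardSuperconductivity.Theorems.KLProgrammeKLRegimeEngineTowerBlockStepWt
import Summits.HubbardSuperconductivity.HubbardSuperconductivity.Theorems.KLProgrammeKLRegimeEngineTowerMeasuredSubadditive
import Summits.HubbardSuperconductivity.HubbardSuperconductivity.Theorems.KLProgrammeKLRegimeEngineTowerParityUnits
import Summits.HubbardSuperconductivity.HubbardSuperconductivity.Theorems.KLProgrammeKLRegimeSplitTwoLegIncrementRep

/-!
# Route `KLProgramme` — crux K3 ENGINE (stmt-HubbardSuperconductivity-20437 `KLRegimeEngineV17F2`), stub (b) v2, THE LEVELS PACKAGE (ℓ):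
# instantiation (I1), MODEL HALF, WEIGHTED TRACK, APPLIED TO THE TOWER'S OWN INCREMENTS — the born weighted pinned sums of `Δ_k` at `F_{J′}`
# (E1-LEVELS-BLUEPRINT-g8 (I1); E1 lead r2d-p2 g8)

`…EngineTowerBlockStepWt` bounds, for ANY even input `G` without constant part, the two pieces of a block step in the weighted currency.  Here `G` is the
tower's own block input `klTowerInput … d k = 𝒱_{dk}[K]` and the output is the block increment `klTowerIncr … d k = Δ_k = 𝒱_{d(k+1)} − 𝒱_{dk}`
(…EngineTowerModelDefs):

* §1 the carrier facts: `constPart_klEffectiveAction_eq_zero` (`Z^K_{Λ_n} ≠ 0 ⇒` no constant part, `constPart_effAction`), `klTowerIncr_eq_effAction_sub`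
  (semigroup `klEffectiveAction_eq_effAction_slice`: `Δ_k = effAction Γ_k 𝒱_{dk} − 𝒱_{dk}`, `Γ_k = C^K_{(Λ_{d(k+1)}, Λ_{dk}]}`), `klTowerIncr_eq_ordersGe2_add_firstOrder`
  (`Δ_k = (effAction Γ_k 𝒱_{dk} − e^{Δ_{Γ_k}}𝒱_{dk}) + (e^{Δ_{Γ_k}}𝒱_{dk} − 𝒱_{dk})`);
* §2 **`klWtPinnedSumOf_klTowerIncr_le`** — for `1 ≤ d`, `1 ≤ k`, `dk ≤ J′`, `Z^K_{Λ_{dk}} ≠ 0` and the block constants of …BlockStepWt (tree weight := the tower's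
  `klScaleWt L M β J′`, leg maps := `latticeLegPos (2·(2M))`): in every even degree `2(q+1)` and at every pin,
  `klWtPinnedSumOf … J′ (2(q+1)) Δ_k ≤ ε_x^{2q+1} · (graded RHS at m = 2q+1 + binomial RHS at q)` in the weighted input sizes `B m′` of `𝒱_{dk}` at `F_{dk−1}`.
  (At `J′ = dk` the left side at its supremum over pins is `klTowerBornWt … d k (2(q+1))`.)
Compositions of landed theorems; nothing about the model is asserted beyond them; nothing asserts superconductivity.
-/

noncomputable section

namespace Summit.HubbardSuperconductivity.HubbardSuperconductivity.Theorems.EngineV8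

set_option linter.dupNamespace false -- summit = problem name (single-conjunct summit), D-0017

open Real Finset Literature.MathematicalPhysics.QuantumLattice Literature.Probability.LatticeModels GrassmannAlgebra
open Summit.HubbardSuperconductivity.HubbardSuperconductivity.Theorems.KLProgrammeLegKernels
open Summit.HubbardSuperconductivity.HubbardSuperconductivity.Theorems.KLRegimeSplit
open Summit.HubbardSuperconductivity.HubbardSuperconductivity.Theorems.KLRegimeWick
open Summit.HubbardSuperconductivity.HubbardSuperconductivity.Theorems.TwoPointAssembly
open Literature.Probability.LatticeModels.BattleFederbush

variable {L M : ℕ} [NeZero L]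

/-! ## §1 Carrier facts -/

/-- **No constant part**: if the partition function of the frame `K` at scale `Λ_n` does not vanish, `𝒱_n[K]` has no constant part. -/
theorem constPart_klEffectiveAction_eq_zero (β U μ : ℝ) (K : TrigPolyC4v) (e₀ : ℝ) (n : ℕ)
    (hZ : hubbardEffPartitionFnCT L M β U μ 0 K (klScale e₀ n) ≠ 0) :
    constPart ℂ (klEffectiveAction L M β U μ K e₀ n) = 0 := by
  rw [klEffectiveAction, hubbardEffectiveActionCT_def]
  exact constPart_effAction ℂ _ _ (isUnit_iff_ne_zero.mpr hZ)

/-- **The block increment is one Gaussian step minus the identity**: `Δ_k = effAction Γ_k 𝒱_{dk} − 𝒱_{dk}`, `Γ_k = C^K_{(Λ_{d(k+1)}, Λ_{dk}]}` (`Z^K_{Λ_{dk}} ≠ 0`). -/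
theorem klTowerIncr_eq_effAction_sub (β U μ : ℝ) (K : TrigPolyC4v) (d k : ℕ)
    (hZ : hubbardEffPartitionFnCT L M β U μ 0 K (klScale klE0 (d * k)) ≠ 0) :
    klTowerIncr L M β U μ K d k =
      effAction ℂ (hubbardCovSliceCT L M β μ 0 K (klScale klE0 (d * (k + 1))) (klScale klE0 (d * k))) (klTowerInput L M β U μ K d k) -
        klTowerInput L M β U μ K d k := by
  unfold klTowerIncr klTowerInput
  rw [klEffectiveAction_eq_effAction_slice β U μ K klE0 (d * (k + 1)) (d * k) hZ]

/-- **Orders ≥ 2 plus first order**: `Δ_k = (effAction Γ_k 𝒱_{dk} − e^{Δ_{Γ_k}} 𝒱_{dk}) + (e^{Δ_{Γ_k}} 𝒱_{dk} − 𝒱_{dk})`. -/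
theorem klTowerIncr_eq_ordersGe2_add_firstOrder (β U μ : ℝ) (K : TrigPolyC4v) (d k : ℕ)
    (hZ : hubbardEffPartitionFnCT L M β U μ 0 K (klScale klE0 (d * k)) ≠ 0) :
    klTowerIncr L M β U μ K d k =
      (effAction ℂ (hubbardCovSliceCT L M β μ 0 K (klScale klE0 (d * (k + 1))) (klScale klE0 (d * k))) (klTowerInput L M β U μ K d k) -
          gaussConv ℂ (hubbardCovSliceCT L M β μ 0 K (klScale klE0 (d * (k + 1))) (klScale klE0 (d * k))) (klTowerInput L M β U μ K d k)) +
        (gaussConv ℂ (hubbardCovSliceCT L M β μ 0 K (klScale klE0 (d * (k + 1))) (klScale klE0 (d * k))) (klTowerInput L M β U μ K d k) -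
          klTowerInput L M β U μ K d k) := by
  rw [klTowerIncr_eq_effAction_sub β U μ K d k hZ]; abel

/-- The weighted pinned sum in degree `m + 1`, with the `ε`-power written as `m` (`rfl`). -/
theorem klWtPinnedSumOf_succ (β μ : ℝ) (K : TrigPolyC4v) (J m : ℕ) (T : HubbardGrassmann L M) (q : Fin (m + 1))
    (w : SpaceTimeIdx L M × SectorLeg (sectorCount J)) :
    klWtPinnedSumOf L M β μ K J (m + 1) T q w = imagTimeWeight β M ^ m *
      ∑ X ∈ univ.filter (fun X : Fin (m + 1) → SpaceTimeIdx L M × SectorLeg (sectorCount J) => X q = w),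
        klScaleWt L M β J ((univ.image X).image (latticeLegPos (2 * (2 * M)))) *
          ‖kernel ℂ (ExteriorAlgebra.map (Matrix.toLin' (sectorAnalysisMatrix L M β (klAnisoFamily L M β μ K klE0 J))) T) (m + 1) X‖ := rfl

/-! ## §2 The born weighted pinned sums of `Δ_k` -/

section Born

variable [NeZero M]

/-- **THE BORN WEIGHTED SIZES OF A BLOCK INCREMENT** (blueprint (I1), weighted track, model half).  `1 ≤ d`, `1 ≤ k`, `dk ≤ J′`, `Z^K_{Λ_{dk}} ≠ 0`; block constants
of …BlockStepWt for the tower's weight `klScaleWt L M β J′` and leg maps `latticeLegPos`; weighted input sizes `B m′` of `𝒱_{dk}` at `F_{dk−1}`.  Then in every even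
degree `2(q+1)` and at every pin `(i, w″)`:
`klWtPinnedSumOf … J′ (2(q+1)) Δ_k i w″ ≤ ε_x^{2q+1} · (graded RHS + binomial RHS)`. -/
theorem klWtPinnedSumOf_klTowerIncr_le {β : ℝ} (hβ : 0 < β) (U μ : ℝ) (K : TrigPolyC4v) {d k J' : ℕ} (hd : 1 ≤ d) (hk : 1 ≤ k) (hJ' : d * k ≤ J')
    (hZ : hubbardEffPartitionFnCT L M β U μ 0 K (klScale klE0 (d * k)) ≠ 0)
    {κ : ℝ} (hκ : 0 < κ)
    (hGB : IsGramBoundedR ((sectorSubMatrix L M β (bgmFatMultiplier L M klE0 β (nambuXiCT L μ K) (d * k - 1))).transpose *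
      hubbardCovSliceCT L M β μ 0 K (klScale klE0 (d * (k + 1))) (klScale klE0 (d * k)) *
        sectorSubMatrix L M β (bgmFatMultiplier L M klE0 β (nambuXiCT L μ K) (d * k - 1))) κ)
    (B : ℕ → ℝ) (hB0 : ∀ m', 0 ≤ B m')
    (hB : ∀ (m' : ℕ) (j : Fin (2 * m')) (w : SpaceTimeIdx L M × SectorLeg (sectorCount (d * k - 1))),
      ∑ Y ∈ univ.filter (fun Y : Fin (2 * m') → SpaceTimeIdx L M × SectorLeg (sectorCount (d * k - 1)) => Y j = w),
        klScaleWt L M β J' ((univ.image Y).image (latticeLegPos (2 * (2 * M)))) *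
          ‖kernel ℂ (ExteriorAlgebra.map (Matrix.toLin' (sectorAnalysisMatrix L M β (klAnisoFamily L M β μ K klE0 (d * k - 1))))
            (klTowerInput L M β U μ K d k)) (2 * m') Y‖ ≤ B m')
    {α : ℝ} (hα : 0 < α)
    (hrow : ∀ X, ∑ Y, ‖((sectorSubMatrix L M β (bgmFatMultiplier L M klE0 β (nambuXiCT L μ K) (d * k - 1))).transpose *
        hubbardCovSliceCT L M β μ 0 K (klScale klE0 (d * (k + 1))) (klScale klE0 (d * k)) *
          sectorSubMatrix L M β (bgmFatMultiplier L M klE0 β (nambuXiCT L μ K) (d * k - 1))) X Y‖ *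
        klScaleWt L M β J' {latticeLegPos (2 * (2 * M)) X, latticeLegPos (2 * (2 * M)) Y} ≤ α)
    (hcol : ∀ Y, ∑ X, ‖((sectorSubMatrix L M β (bgmFatMultiplier L M klE0 β (nambuXiCT L μ K) (d * k - 1))).transpose *
        hubbardCovSliceCT L M β μ 0 K (klScale klE0 (d * (k + 1))) (klScale klE0 (d * k)) *
          sectorSubMatrix L M β (bgmFatMultiplier L M klE0 β (nambuXiCT L μ K) (d * k - 1))) X Y‖ *
        klScaleWt L M β J' {latticeLegPos (2 * (2 * M)) X, latticeLegPos (2 * (2 * M)) Y} ≤ α)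
    {ρ : ℝ} (hρ : 0 < ρ)
    (hθ : Real.exp 1 * α * normV (SpaceTimeIdx L M × SectorLeg (sectorCount (d * k - 1))) κ ρ
      (fun m' => imagTimeWeight β M ^ (2 * m') * B m') / κ ^ 2 < 1)
    {cr cc : ℝ} (hcc0 : 0 ≤ cc)
    (hrow' : ∀ X'', ∑ X', ‖(sectorAnalysisMatrix L M β (klAnisoFamily L M β μ K klE0 J') *
        sectorSubMatrix L M β (bgmFatMultiplier L M klE0 β (nambuXiCT L μ K) (d * k - 1))) X'' X'‖ *
        klScaleWt L M β J' {latticeLegPos (2 * (2 * M)) X'', latticeLegPos (2 * (2 * M)) X'} ≤ cr)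
    (hcol' : ∀ X', ∑ X'', ‖(sectorAnalysisMatrix L M β (klAnisoFamily L M β μ K klE0 J') *
        sectorSubMatrix L M β (bgmFatMultiplier L M klE0 β (nambuXiCT L μ K) (d * k - 1))) X'' X'‖ *
        klScaleWt L M β J' {latticeLegPos (2 * (2 * M)) X'', latticeLegPos (2 * (2 * M)) X'} ≤ cc)
    {N₀ : ℕ} (hN₀ : 2 ≤ N₀) (q : ℕ) (i : Fin (2 * (q + 1))) (w'' : SpaceTimeIdx L M × SectorLeg (sectorCount J')) :
    klWtPinnedSumOf L M β μ K J' (2 * (q + 1)) (klTowerIncr L M β U μ K d k) i w'' ≤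
      imagTimeWeight β M ^ (2 * q + 1) *
        (cr * cc ^ (2 * q + 1) *
          (∑ n ∈ Ico 2 N₀, (ρ⁻¹ ^ (2 * q + 1 + 1) * κ⁻¹ ^ (2 * (n - 1)) * (α ^ (n - 1) * Real.exp n)) *
              ∑ δ ∈ (Fintype.piFinset fun _ : Fin n => range (Fintype.card (SpaceTimeIdx L M × SectorLeg (sectorCount (d * k - 1))) / 2 + 1)) with
                  2 * q + 1 + 1 + 2 * (n - 1) ≤ ∑ a, 2 * δ a,
                ∏ a, (Real.exp 2 * (κ + ρ)) ^ (2 * δ a) * (imagTimeWeight β M ^ (2 * δ a) * B (δ a)) +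
            ρ⁻¹ ^ (2 * q + 1 + 1) *
              (Real.exp 1 * normV (SpaceTimeIdx L M × SectorLeg (sectorCount (d * k - 1))) κ ρ (fun m' => imagTimeWeight β M ^ (2 * m') * B m')) *
              (Real.exp 1 * α * normV (SpaceTimeIdx L M × SectorLeg (sectorCount (d * k - 1))) κ ρ
                  (fun m' => imagTimeWeight β M ^ (2 * m') * B m') / κ ^ 2) ^ (N₀ - 1) /
              (1 - Real.exp 1 * α * normV (SpaceTimeIdx L M × SectorLeg (sectorCount (d * k - 1))) κ ρ
                  (fun m' => imagTimeWeight β M ^ (2 * m') * B m') / κ ^ 2)) +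
        cr * cc ^ (2 * q + 1) *
          ∑ m' ∈ range (Fintype.card (SpaceTimeIdx L M × SectorLeg (sectorCount (d * k - 1))) / 2 + 1),
            (if q + 1 < m' then ((2 * m').choose (2 * (q + 1)) : ℝ) * κ ^ (2 * m' - 2 * (q + 1)) *
              (imagTimeWeight β M ^ (2 * m') * B m') else 0)) := by
  have hβ' : β ≠ 0 := hβ.ne'
  have hJ₁ : 1 ≤ d * k := le_trans hd (Nat.le_mul_of_pos_right d hk)
  have hJ : d * k ≤ d * (k + 1) := Nat.mul_le_mul_left d (Nat.le_succ k)
  have hwt := isTreeWeight_klScaleWt L M hβ.le J'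
  have hG : klTowerInput L M β U μ K d k ∈ evenPart ℂ (HubbardFieldIdx L M) := klEffectiveAction_mem_evenPart hβ' U μ K klE0 (d * k)
  have hG0 : constPart ℂ (klTowerInput L M β U μ K d k) = 0 := constPart_klEffectiveAction_eq_zero β U μ K klE0 (d * k) hZ
  have hε : 0 ≤ imagTimeWeight β M := imagTimeWeight_nonneg hβ.le M
  -- split the increment and the pinned sum
  have h2 := blockStep_ordersGe2_wt_le (L := L) (M := M) hwt hβ μ K hJ₁ hJ hJ' (latticeLegPos (2 * (2 * M))) (latticeLegPos (2 * (2 * M)))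
    (klTowerInput L M β U μ K d k) hG hG0 hκ hGB B hB0 hB hα hrow hcol hρ hθ hcc0 hrow' hcol' hN₀ (2 * q + 1) i w''
  have h1 := blockStep_firstOrder_wt_le (L := L) (M := M) hwt hβ μ K hJ₁ hJ hJ' (latticeLegPos (2 * (2 * M))) (latticeLegPos (2 * (2 * M)))
    (klTowerInput L M β U μ K d k) hG hκ.le hGB B hB0 hB hcc0 hrow' hcol' q i w''
  rw [klTowerIncr_eq_ordersGe2_add_firstOrder β U μ K d k hZ]
  refine (klWtPinnedSumOf_add_le hβ.le μ K J' _ _ _ i w'').trans ?_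
  rw [mul_add (imagTimeWeight β M ^ (2 * q + 1))]
  exact add_le_add
    ((klWtPinnedSumOf_succ β μ K J' (2 * q + 1) _ i w'').trans_le (mul_le_mul_of_nonneg_left h2 (pow_nonneg hε _)))
    ((klWtPinnedSumOf_succ β μ K J' (2 * q + 1) _ i w'').trans_le (mul_le_mul_of_nonneg_left h1 (pow_nonneg hε _)))

end Born

end Summit.HubbardSuperconductivity.HubbardSuperconductivity.Theorems.EngineV8

end
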